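import Literature.NumberTheory.Sieve.HeathBrownSSumLemma1
import HarnessLib

/-!
# The Birch–Bombieri bound `|S′(α, β)| ≤ c₁ p^{3/2}` — the named fact

Topic `Literature/NumberTheory/Sieve`. ONE named fact (D-0014), no proofs:
`BirchBombieri1985_Sprime_bound`, VERBATIM the hypothesis binder `hBB` (with its constant:
`∃ c₁, …`, the reduction taking `{C} (hC : 0 ≤ C) (hBB : … ≤ C * p^{3/2})`) of the accepted reduction
`Literature.NumberTheory.Sieve.FouvryTenenbaum2021_lemma413_of_deligne_birchBombieri`
(`FouvryTenenbaumDivisorAPLemma413DeligneBB.lean`, p116194) — librarian sweep g24, vend-from-binder,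
promote event 3359118. Companion: `HyperKloostermanDeligneBound.lean` (binder `hD`). Glue (the
consumer's `_of_facts`, 6 lines): from `⟨c₁, h⟩` take `C := max c₁ 0`, `hC := le_max_right _ _`
and `hBB := fun p _ α β hα hβ ↦ (h p α β hα hβ).trans (by gcongr; exact le_max_left _ _)`.

## Source and reading

Heath-Brown, *The divisor function `d₃(n)` in arithmetic progressions*, Acta Arith. 47 (1986), §3,
p. 37: for the sum `S′ = S′(α, β) = ∑*_{x,y,X,Y : α x̄ȳ + β X̄Ȳ ≡ 1 (p)} e_p(x + y + X + Y)`
(the tree's `HeathBrown1986.BBsum p α β`, `HeathBrownSSumLemma1.lean`) "Birch and Bombieri ([10],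
appendix) obtained `|S′| ≤ c₁ p^{3/2}` for `p ∤ αβ`" — [10] = Friedlander–Iwaniec, *Incomplete
Kloosterman sums and a divisor problem*, Ann. of Math. 121 (1985), Appendix by B. J. Birch and
E. Bombieri (Theorem). A Deligne-level statement (purity of a rank-`2` Kloosterman–Möbius sheaf);
the unconditional Weil-level bound `4p(p − 2)` and the normal form of `S′` are proved in the tree
(p117694) but do not give the exponent `3/2`.

What is deliberately NOT here: the value of `c₁`; the case `p ∣ αβ`.
-/

noncomputable section

namespace Literature.NumberTheory.Sieve

/-- **Birch–Bombieri (appendix to Friedlander–Iwaniec 1985): `|S′(α, β)| ≤ c₁ p^{3/2}`.** There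
is an absolute constant `c₁` such that for every prime `p` and all non-zero `α β ∈ ℤ/p`,
`‖HeathBrown1986.BBsum p α β‖ ≤ c₁ · p^{3/2}`, where
`BBsum p α β = ∑*_{x,y,X,Y : α x̄ȳ + β X̄Ȳ = 1} e_p(x + y + X + Y)` (Heath-Brown 1986, §3 p. 37,
quoting Birch–Bombieri). VERBATIM the binder `hBB` of
`FouvryTenenbaum2021_lemma413_of_deligne_birchBombieri` with its constant existentially bound;
users take `(hBB : BirchBombieri1985_Sprime_bound)`. Named fact (D-0014), not proved in the tree
(Deligne-level input).
[cite: HeathBrown1986d3, §3 p. 37 (the bound of Birch and Bombieri for S′)]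
[cite: FriedlanderIwaniec1985, Appendix (B. J. Birch and E. Bombieri), Theorem] -/
def BirchBombieri1985_Sprime_bound : Prop :=
  ∃ c₁ : ℝ, ∀ (p : ℕ) [Fact p.Prime] (α β : ZMod p), α ≠ 0 → β ≠ 0 →
    ‖HeathBrown1986.BBsum p α β‖ ≤ c₁ * (p : ℝ) ^ (3 / 2 : ℝ)

end Literature.NumberTheory.Sieve

end
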